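import Summits.ResolutionOfSingularities.ResolutionOfSingularities.Theorems.FrobeniusClosingPatchingRelPerfectDepthMultiHostFormat
import Summits.ResolutionOfSingularities.ResolutionOfSingularities.Theorems.FrobeniusClosingPatchingRelPerfectDepthSNCPointwiseTransport
import Summits.ResolutionOfSingularities.ResolutionOfSingularities.Theorems.FrobeniusClosingPatchingRelPerfectDepthSNCExchange
import Summits.ResolutionOfSingularities.ResolutionOfSingularities.Theorems.FrobeniusClosingPatchingRelPerfectDepthSepFormatStepLemmas
import HarnessLib

/-!
# Crux `PatchingRelPerfect` (stmt-ResolutionOfSingularities-16161), chain W5.2 — F7(β) (β-AX): INV-H-STEP₁ —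
# a host of CENTRE-ORDER ONE that is snc with the members stays snc with the members after the step

[OURS · L1 W5.2 · F7(β) (β-AX) · res-L1-w52-plan-1 RULING G12-41 (1b) naming «stub-1΄s TRUE STEP INV-H-STEP₁ … module
`…DepthPhaseCHostSncStep`», after K18-cex (the ∀-hosts clause is false: h = y² − x³, centre V(x,y), m = 2)] res-L1-w52-stub-1 g5.  Replaces the
role of NO printed item; NOT a statement of the manuscript under review (AI-written, weaker than expert review).

**`sncWithAt_host_step`**: `X` regular (locally Noetherian, Noetherian space), `W` a regular irreducible centre snc with the members
(`hsnc`), a host `S.host i` that is effective Cartier with ORDER ONE AT EVERY POINT OF `W` (the v7 exponent `m i = 1`, delivered pointwise by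
`CylState.hequiX_of_binders`, p566263), and `x′ ↦ x ∈ W` with `(S.𝓔 ++ [S.host i])` snc at `x`.  Then `(S′.𝓔 ++ [S′.host i])` is snc at `x′`
for `S′ = S.step τ W η m ν hsnc hτ`.  Three tree pieces and nothing else: the POINTWISE EXCHANGE `DepthSNC.SNCWithAt.cons_of_stalkIdeal_le`
(host ∋ centre ⇒ `host :: members` snc WITH the centre at `x`, Kollár 3.104 Step 2.1), the POINTWISE TRANSPORT
`IsBlowup.sncWithAt_transform` (Kollár Def. 3.25 at one point), and «strict transform = weight-one controlled transform» for an order-one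
Cartier divisor through the centre (`DepthGraded.SepStep.strictTransformIdeal_eq_controlledTransform_one`, Kollár 3.30.2).  Off the centre and
for `m i = 0` nothing is claimed (local isomorphism / the host misses the point); hosts of centre-order `≥ 2` are the newborn-pole case K18-cex
and are correctly excluded.  Fact-free.
-/

-- `Summit.<Summit>.<Sub>.Theorems` with `Sub = Summit` (single-conjunct summit, D-0017)
set_option linter.dupNamespace false

noncomputable section

open CategoryTheory AlgebraicGeometry TopologicalSpace IsLocalRing
open Literature.AlgebraicGeometry.Resolution Scheme.IdealSheafData

namespace Summit.ResolutionOfSingularities.ResolutionOfSingularities.Theorems.DepthMultiHost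

universe u

variable {X X' : Scheme.{u}} [IsLocallyNoetherian X] [NoetherianSpace X]

omit [IsLocallyNoetherian X] [NoetherianSpace X] in
/-- A host of order one at every point of the centre contains the centre. [folklore] -/
theorem host_le_vanishingIdeal_of_idealOrder_eq_one {H : X.IdealSheafData} {W : Closeds X}
    (hequi : ∀ y ∈ (W : Set X), idealOrder H y = 1) : H ≤ vanishingIdeal W := by
  refine le_support_iff_le_vanishingIdeal.mp fun y hy => ?_
  rw [← one_le_idealOrder_iff, hequi y hy]

/-- [OURS · L1 W5.2 · F7(β) (β-AX) · INV-H-STEP₁] **A host of centre-order ONE that is snc with the members at `x = τ x′ ∈ W` stays snc with the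
members (strict transforms ++ the exceptional divisor) at `x′` after the step.** [cite: Kollar2007, 3.104 Step 2.1, Def. 3.25, 3.30.2] -/
theorem sncWithAt_host_step (hX : Scheme.IsRegular X) (S : MultiHostState X) (τ : X' ⟶ X) (W : Closeds X) (η : X)
    (m : Fin S.n → ℕ) (ν : ℕ) (hsnc : HasSNCWith S.𝓔 (vanishingIdeal W)) (hτ : IsBlowup τ (vanishingIdeal W))
    (hW : Scheme.IsRegular (vanishingIdeal W).subscheme) (hη : IsGenericPoint η (W : Set X)) (i : Fin S.n)
    (hhost : IsEffectiveCartier (S.host i)) (hmi : m i = 1) (hequi : ∀ y ∈ (W : Set X), idealOrder (S.host i) y = 1) {x' : X'}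
    (hH : DepthSNC.SNCWithAt (S.𝓔 ++ [S.host i]) ⊤ (τ x')) :
    DepthSNC.SNCWithAt ((S.step τ W η m ν hsnc hτ).𝓔 ++ [(S.step τ W η m ν hsnc hτ).host i]) ⊤ x' := by
  classical
  set C := vanishingIdeal W with hC_def
  -- the host contains the centre
  have hle : S.host i ≤ C := host_le_vanishingIdeal_of_idealOrder_eq_one hequi
  -- (1) EXCHANGE at `x = τ x'`: `host :: members` is snc WITH the centre
  have hℬ : DepthSNC.SNCWithAt S.𝓔 C (τ x') := hsnc.sncWithAt (τ x')
  have hH' : DepthSNC.SNCWithAt (S.host i :: S.𝓔) ⊤ (τ x') :=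
    hH.congr_mem fun D _ => by simp only [List.mem_cons, List.mem_append]; tauto
  have hcons : DepthSNC.SNCWithAt (S.host i :: S.𝓔) C (τ x') :=
    hℬ.cons_of_stalkIdeal_le hH' (stalkIdeal_mono hle _) fun B hB _ => ⟨hB, Or.inl hB⟩
  -- (2) TRANSPORT through the blow-up
  have htrans := hτ.sncWithAt_transform x' hcons
  -- (3) strict transform = weight-one controlled transform for the order-one host through the centre
  have hWsupp : ((C.support : Closeds X) : Set X) = (W : Set X) := Scheme.IdealSheafData.coe_support_vanishingIdeal W
  have hconn : _root_.IsPreconnected (C.support : Set X) := by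
    rw [hWsupp]; exact hη.isIrreducible.isPreirreducible.isPreconnected
  have hord : ∀ y : X, y ∈ C.support → ¬ stalkIdeal (S.host i) y ≤ maximalIdeal (X.presheaf.stalk y) ^ 2 := by
    intro y hy h2
    have hyW : y ∈ (W : Set X) := by rw [← hWsupp]; exact hy
    have := (le_idealOrder_iff (S.host i) y 2).mpr h2
    rw [hequi y hyW] at this
    exact absurd this (by decide)
  have heq : strictTransformIdeal τ C (S.host i) = controlledTransform τ C (S.host i) 1 :=
    DepthGraded.SepStep.strictTransformIdeal_eq_controlledTransform_one hX hW hconn hhost hle hhost hle hτ hord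
  -- assemble: the two lists have the same members
  rw [MultiHostState.step_𝓔, MultiHostState.step_host, hmi, ← hC_def, ← heq]
  refine htrans.congr_mem fun D _ => ?_
  simp only [List.map_cons, List.cons_append, List.mem_cons, List.mem_append, List.not_mem_nil, or_false, List.mem_map]
  constructor
  · rintro ((h | h) | h)
    exacts [Or.inr (Or.inl h), Or.inr (Or.inr h), Or.inl h]
  · rintro (h | h | h)
    exacts [Or.inr h, Or.inl (Or.inl h), Or.inl (Or.inr h)]

end Summit.ResolutionOfSingularities.ResolutionOfSingularities.Theorems.DepthMultiHost

end
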